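import Summits.BirchSwinnertonDyer.BirchSwinnertonDyer.Theorems.GenusKolyvaginAtTwoOffCutResidualAtTwoRSocleSelectionRealVisibleInvolution
import Summits.BirchSwinnertonDyer.BirchSwinnertonDyer.Theorems.GenusKolyvaginAtTwoGenusPrimitiveSupplyAtTwoArchimedeanEgg
import Literature.NumberTheory.EllipticCurves.LocalTorsionInvariants
import Literature.NumberTheory.EllipticCurves.ArchimedeanKummerImageMaximal
import Literature.NumberTheory.EllipticCurves.SelmerProofs
import Literature.NumberTheory.EllipticCurves.GaloisActionProofs
import Literature.NumberTheory.GaloisRepresentations.AbsGaloisRestrictRealPlace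
import HarnessLib

/-!
# Route `GenusKolyvaginAtTwo`, residual `OffCutResidualAtTwoR` (stmt-BirchSwinnertonDyer-31767), LINE 27 «socle_selection» STUB S2a (HL) —
# THE ARCHIMEDEAN INPUTS: for `Δ > 0` complex conjugation FIXES `E[2]`, MOVES `E[4]`, and FIXES A POINT OF ORDER `4`;
# ★ a REAL-TRIVIAL PHANTOM CLASS OF `H¹(ℚ, E[2^k])` IS ZERO (`k ≥ 2`, `ρ̄_{E,2^k}` onto, `Δ > 0`) — UNCONDITIONAL

Seat `bsd-line-gk2-p4` g30 (cell `bsd-f1-sign2`), WIDTH-5 attach on route `GenusKolyvaginAtTwo` rev 59.  `--supports stmt-BirchSwinnertonDyer-31767 --as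
helper`.  THEOREMS ONLY (no definition, no named fact, no `sorry`); standard axioms.  **BSD is NOT proved by this file; `OffCutResidualAtTwoR` is NOT
proved; LINE 27's stub S2a (HL) is NOT closed by this file alone** (it still wants the ℚ ↔ K descent of phantom classes and the Heegner-socle
identification of LEAD gk2-p1 g25's `…HeegnerSocleSOC`).

This file discharges the three archimedean hypotheses `hfix` / `hne` / `hne'` of `…RealVisibleInvolution`'s
`eq_zero_of_phantom_of_mem_torsionLocalKer_infinitePlace_of_isReal` for `K = ℚ`, `Δ > 0`, by TRANSFER from the `F`-rational points of `E/F`,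
`F = ℚ_∞ ≃+* ℝ`, along the tree's equivariant bijection `kerZSMulToInvariants : E(F)[n] ≃ H⁰(F, E[n])` (`LocalTorsionInvariants.lean`):

* §1 TRANSFER (any `K` of characteristic `0`, any `K`-field `F` of characteristic `0`):
  `exists_invariant_of_order_four` — an `F`-point of order `4` gives a `Γ_F`-INVARIANT geometric point `R` with `4R = 0`, `2R ≠ 0`;
  `exists_smul_ne_of_not_two_divisible` — an `F`-rational `2`-torsion point NOT in `2E(F)` gives a geometric `R` with `4R = 0` MOVED by some
  `τ ∈ Γ_F` (halve it in `E(K̄)`; were the half invariant it would be `F`-rational by Galois descent); `smul_eq_self_of_card_twoTorsion` —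
  `#E(F)[2] ≥ 4 ⟹ Γ_F` fixes `E[2]` (`#E[2] = 4`, `AddSubgroup.eq_top_of_le_card`).
* §2 REAL ALGEBRA (`K = ℚ`, `Δ > 0`, `F ≃+* ℝ` a `ℚ`-field): `exists_splitTwoTorsion_real_lt` (three real roots, sorted);
  `exists_twoTorsion_baseChange_of_ringEquiv` — three distinct `F`-rational points of order `2`, the one with the smallest abscissa NOT in `2E(F)`
  (tree `add_self_ne_of_lt`: doubling never lands below a `2`-torsion abscissa), the one with the largest abscissa IN `2E(F)` (complete `2`-descent,
  positive reals are squares); `four_le_natCard_ker_two` — `#E(F)[2] ≥ 4`.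
* §3 `smul_eq_self_of_two_smul_eq_zero` (every `τ ∈ Γ_F` fixes `E[2]`), `exists_four_torsion_smul_ne` (some `τ ∈ Γ_F` moves some `R ∈ E[4]`),
  `exists_four_torsion_invariant` (a `Γ_F`-invariant `R ∈ E[4]` of order `4`) — Kramer's `E(ℝ)[2] = E[2]`, `E(ℝ)[4] ≅ ℤ/4 × ℤ/2` for `Δ > 0` in the
  form the visibility criterion consumes.
* §4 ★ `eq_zero_of_phantom_of_mem_torsionLocalKer_rat` — `E/ℚ` elliptic, `Δ > 0`, `ρ̄_{E,2^{k}}` surjective, `k = j + 1 ≥ 2`: every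
  `x ∈ H¹(ℚ, E[2^k])` with `[x, ρ] = 0` for all `ρ ∈ Γ_{ℚ(E[2^k])}` (phantom) lying in `torsionLocalKer ℚ_∞ 2^k` (real-trivial) is `0`.  This is
  [LawsonWuthrich2016] §7.1's remark that the non-trivial class of `H¹(GL₂(ℤ/2^k), (ℤ/2^k)²) = ℤ/2` does not localise to zero at the real place,
  made unconditional in the kernel for every `E/ℚ` with `Δ > 0` and surjective `ρ̄_{E,2^k}`.
BSD is NOT proved by any of this.

References: [LawsonWuthrich2016] Lemma 3, §7.1; [Kramer1981] §2 Prop. 6 (p. 127); [SilvermanAEC2009] III.2.3(d), VIII.§1, X.1.4; [MilneADT2006]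
I Lemma 3.3, Rem. 3.7; [SerreGaloisCohomology1997] II.§6.1.
-/

set_option autoImplicit false
set_option linter.dupNamespace false -- `Summit.<P>.<Sub>` repeats `BirchSwinnertonDyer` (D-0017)

noncomputable section

open scoped Classical

namespace Summit.BirchSwinnertonDyer.BirchSwinnertonDyer.Theorems.GenusExact.PlusDescent.SocleSelection.RealVisible

open WeierstrassCurve Field NumberField Literature.NumberTheory.EllipticCurves Literature.NumberTheory.GaloisRepresentations

universe u

/-! ## §1 Transfer `E(F)[n] ↔ H⁰(F, E[n])` -/

section Transfer

variable {K : Type u} [Field K] [CharZero K] (W : WeierstrassCurve K) [W.IsElliptic]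
variable (F : Type u) [Field F] [Algebra K F] [CharZero F]

/-- **An `F`-point of order `4` gives a `Γ_F`-invariant geometric point of order `4`.**  For `Q ∈ E(F)` with `4Q = 0`, `2Q ≠ 0`, the transfer
`R = kerZSMulToInvariants Q ∈ H⁰(F, E[4]) ⊆ E[4](K̄)` is `Γ_F`-invariant (`Γ_F` acting through `absGaloisRestrict K F`), and `2R ≠ 0` since the
transfer is additive and injective (`kerZSMulToInvariants_bijective`). [cite: SilvermanAEC2009, VIII.§1 (proof of Prop. 1.2)] [cite: MilneADT2006, I Lemma 3.3] -/
theorem exists_invariant_of_order_four (Q : (W.baseChange F).toAffine.Point) (hQ4 : (4 : ℤ) • Q = 0)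
    (hQ2 : (2 : ℤ) • Q ≠ 0) :
    ∃ R : geomPoints W, (4 : ℤ) • R = 0 ∧ (2 : ℤ) • R ≠ 0 ∧
      ∀ τ : absoluteGaloisGroup F, absGaloisRestrict K F τ • R = R := by
  have h4 : (4 : ℤ) ≠ 0 := by norm_num
  let Q4 : (zsmulAddGroupHom (4 : ℤ) : (W.baseChange F).toAffine.Point →+ _).ker :=
    ⟨Q, by rw [AddMonoidHom.mem_ker, zsmulAddGroupHom_apply]; exact hQ4⟩
  let X := W.kerZSMulToInvariants F h4 Q4
  refine ⟨((X : geomTorsion W 4) : geomPoints W), ?_, ?_, ?_⟩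
  · exact (mem_geomTorsion_iff W 4 _).mp (X : geomTorsion W 4).2
  · intro h2
    apply hQ2
    have h2X : (2 : ℤ) • X = 0 := by
      apply Subtype.ext
      apply Subtype.ext
      change (((((2 : ℤ) • X : _) : geomTorsion W 4)) : geomPoints W) = ((((0 : _) : geomTorsion W 4)) : geomPoints W)
      rw [Submodule.coe_smul_of_tower, AddSubgroupClass.coe_zsmul, h2]
      rfl
    have hk : W.kerZSMulToInvariants F h4 ((2 : ℤ) • Q4) = 0 := by rw [map_zsmul, h2X]
    have h0 : (2 : ℤ) • Q4 = 0 := (W.kerZSMulToInvariants_bijective F h4).1 (by rw [hk, map_zero])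
    have h0' := congrArg Subtype.val h0
    simpa using h0'
  · intro τ
    have hmem := X.2
    rw [ContinuousRep.mem_invariants] at hmem
    have h := hmem τ
    rw [restrictField_torsionGaloisModule_apply] at h
    have h' := congrArg Subtype.val h
    rwa [AddSubgroup.torsionBy.coe_smul] at h'

/-- **An `F`-rational `2`-torsion point outside `2E(F)` gives a geometric `4`-torsion point MOVED by `Γ_F`.**  Halve the transfer of `P` in the
divisible group `E(K̄)`: `2R = P`, `4R = 0`.  Were `R` fixed by every `τ ∈ Γ_F`, it would lie in `H⁰(F, E[4])`, hence be the transfer of an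
`F`-rational `Q` (`kerZSMulToInvariants_bijective`, Galois descent `E(F̄)^{Γ_F} = E(F)`), and `2Q = P` in `E(F)` (`toGeomPoints` injective) —
excluded. [cite: SilvermanAEC2009, VIII.§1 (proof of Prop. 1.2)] [cite: MilneADT2006, I Lemma 3.3] -/
theorem exists_smul_ne_of_not_two_divisible (P : (W.baseChange F).toAffine.Point) (hP2 : (2 : ℤ) • P = 0)
    (hP : ∀ Q : (W.baseChange F).toAffine.Point, (2 : ℤ) • Q ≠ P) :
    ∃ R : geomPoints W, (4 : ℤ) • R = 0 ∧
      ∃ τ : absoluteGaloisGroup F, absGaloisRestrict K F τ • R ≠ R := by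
  have h4 : (4 : ℤ) ≠ 0 := by norm_num
  have hP4 : (4 : ℤ) • P = 0 := by
    rw [show (4 : ℤ) = 2 * 2 by norm_num, mul_zsmul, hP2, zsmul_zero]
  let P4 : (zsmulAddGroupHom (4 : ℤ) : (W.baseChange F).toAffine.Point →+ _).ker :=
    ⟨P, by rw [AddMonoidHom.mem_ker, zsmulAddGroupHom_apply]; exact hP4⟩
  let X := W.kerZSMulToInvariants F h4 P4
  obtain ⟨R, hR⟩ := W.zsmul_geomPoints_surjective_of_charZero (n := 2) two_ne_zero
    ((X : geomTorsion W 4) : geomPoints W)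
  have hR' : (2 : ℤ) • R = ((X : geomTorsion W 4) : geomPoints W) := hR
  have h2P4 : (2 : ℤ) • P4 = 0 := Subtype.ext (by
    change (2 : ℤ) • P = 0
    exact hP2)
  have h2X : (2 : ℤ) • X = 0 := by rw [← map_zsmul, h2P4, map_zero]
  have hR4 : (4 : ℤ) • R = 0 := by
    rw [show (4 : ℤ) = 2 * 2 by norm_num, mul_zsmul, hR', ← AddSubgroupClass.coe_zsmul,
      ← Submodule.coe_smul_of_tower, h2X]
    rfl
  refine ⟨R, hR4, ?_⟩
  by_contra hall
  push Not at hall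
  let R4 : geomTorsion W 4 := ⟨R, (mem_geomTorsion_iff W 4 R).mpr hR4⟩
  have hR4mem : R4 ∈ (GaloisRep.restrictField F (W.torsionGaloisModule 4)).invariants := by
    rw [ContinuousRep.mem_invariants]
    intro τ
    rw [restrictField_torsionGaloisModule_apply]
    exact Subtype.ext (by rw [AddSubgroup.torsionBy.coe_smul]; exact hall τ)
  obtain ⟨Q4, hQ4⟩ := (W.kerZSMulToInvariants_bijective F h4).2 ⟨R4, hR4mem⟩
  have hA := W.torsionTransferEquiv_kerZSMulToInvariants F h4 Q4
  rw [hQ4] at hA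
  change ((W.torsionTransferEquiv (E := F) h4 R4 : geomTorsion (W.baseChange F) 4) :
    geomPoints (W.baseChange F)) = toGeomPoints (W.baseChange F) (Q4 : (W.baseChange F).toAffine.Point) at hA
  have hAX := W.torsionTransferEquiv_kerZSMulToInvariants F h4 P4
  have h2R4 : (2 : ℤ) • R4 = (X : geomTorsion W 4) :=
    Subtype.ext (by rw [AddSubgroupClass.coe_zsmul]; exact hR')
  apply hP (Q4 : (W.baseChange F).toAffine.Point)
  apply toGeomPoints_injective (W.baseChange F)
  rw [map_zsmul, ← hA, ← AddSubgroupClass.coe_zsmul, ← map_zsmul, h2R4]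
  exact hAX

/-- **`#E(F)[2] ≥ 4 ⟹ Γ_F` fixes `E[2]` pointwise.**  `H⁰(F, E[2]) ≃ E(F)[2]` (`invariantsTorsionEquivKerZSMul`) has at least `4 = #E[2](K̄)`
(`card_torsionPoints_eq_sq_holds`) elements, so it is all of `E[2]` (`AddSubgroup.eq_top_of_le_card`). [cite: MilneADT2006, I Lemma 3.3]
[cite: SilvermanAEC2009, Cor. III.6.4(b)] -/
theorem smul_eq_self_of_card_twoTorsion
    (hcard : 4 ≤ Nat.card (zsmulAddGroupHom (2 : ℤ) : (W.baseChange F).toAffine.Point →+ _).ker)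
    (τ : absoluteGaloisGroup F) (T : geomPoints W) (hT : (2 : ℤ) • T = 0) :
    absGaloisRestrict K F τ • T = T := by
  have h2 : (2 : ℤ) ≠ 0 := two_ne_zero
  have hcardE : Nat.card (geomTorsion W 2) = 4 :=
    card_torsionPoints_eq_sq_holds W (AlgebraicClosure K) (n := 2) (by norm_num)
  haveI : Finite (geomTorsion W 2) := Nat.finite_of_card_ne_zero (by rw [hcardE]; norm_num)
  let S := (GaloisRep.restrictField F (W.torsionGaloisModule 2)).invariants
  have hcardS : Nat.card (geomTorsion W 2) ≤ Nat.card S.toAddSubgroup := by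
    change Nat.card (geomTorsion W 2) ≤ Nat.card S
    rw [hcardE, Nat.card_congr (W.invariantsTorsionEquivKerZSMul F h2).toEquiv]
    exact hcard
  have htop : S.toAddSubgroup = ⊤ := AddSubgroup.eq_top_of_le_card _ hcardS
  have hmem : (⟨T, (mem_geomTorsion_iff W 2 T).mpr hT⟩ : geomTorsion W 2) ∈ S := by
    have h : (⟨T, (mem_geomTorsion_iff W 2 T).mpr hT⟩ : geomTorsion W 2) ∈ S.toAddSubgroup := by
      rw [htop]; exact AddSubgroup.mem_top _
    exact h
  rw [ContinuousRep.mem_invariants] at hmem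
  have h := hmem τ
  rw [restrictField_torsionGaloisModule_apply] at h
  have h' := congrArg Subtype.val h
  rwa [AddSubgroup.torsionBy.coe_smul] at h'

end Transfer

/-! ## §2 Real algebra: `Δ > 0` — three real `2`-torsion points, the smallest not halvable, the largest halvable -/

section RealAlgebra

open WeierstrassCurve.Affine

variable (W : WeierstrassCurve ℚ) [W.IsElliptic]

/-- **`Δ > 0`: the `2`-division cubic of `E/ℝ` has three real roots, listed with the largest last** (tree
`exists_splitTwoTorsion_baseChange_real_of_Δ_pos`, sorted by `swap₁₂` / `swap₂₃`). [cite: Kramer1981, §2 Prop. 6 (p. 127)] -/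
theorem exists_splitTwoTorsion_real_lt (hΔ : 0 < W.Δ) :
    ∃ e₁ e₂ e₃ : ℝ, (W.baseChange ℝ).toAffine.SplitTwoTorsion e₁ e₂ e₃ ∧ e₁ < e₃ ∧ e₂ < e₃ := by
  obtain ⟨r₁, r₂, r₃, hs⟩ := GenusKolyArch.exists_splitTwoTorsion_baseChange_real_of_Δ_pos W hΔ
  rcases lt_or_gt_of_ne hs.ne₁₃ with h13 | h31
  · rcases lt_or_gt_of_ne hs.ne₂₃ with h23 | h32
    · exact ⟨r₁, r₂, r₃, hs, h13, h23⟩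
    · exact ⟨r₁, r₃, r₂, hs.swap₂₃, h13.trans h32, h32⟩
  · rcases lt_or_gt_of_ne hs.ne₁₂ with h12 | h21
    · exact ⟨r₁, r₃, r₂, hs.swap₂₃, h12, h31.trans h12⟩
    · exact ⟨r₂, r₃, r₁, hs.swap₁₂.swap₂₃, h21, h31⟩

variable {F : Type} [Field F] [Algebra ℚ F]

/-- **The real `2`- and `4`-torsion of `E`, read in a `ℚ`-field `F ≃+* ℝ`** (`Δ > 0`): three distinct `F`-rational points `P₁, P₂, P₃` of order
`2`; `P₁` (smallest real abscissa) is NOT in `2E(F)` — a double `2R = (X, ·)` has `X ≥` every `2`-torsion abscissa (tree `add_self_ne_of_lt`,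
duplication formula), read in `ℝ` along `F → ℝ`; `P₃` (largest abscissa) IS `2Q` for an `F`-point `Q` — `e₃ - e₁, e₃ - e₂ > 0` are real squares,
complete `2`-descent `exists_add_self_of_twoDescentComponent_eq_one`, transported along `ℝ → F`.  (`E(ℝ) ≅ S¹ × ℤ/2`: `E(ℝ)[2] = E[2]`,
`E(ℝ)[4] ≅ ℤ/4 × ℤ/2`.) [cite: Kramer1981, §2 Prop. 6 (p. 127)] [cite: SilvermanAEC2009, III.2.3(d) and Prop. X.1.4] -/
theorem exists_twoTorsion_baseChange_of_ringEquiv (e : F ≃+* ℝ) (hΔ : 0 < W.Δ) :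
    ∃ P₁ P₂ P₃ Q : (W.baseChange F).toAffine.Point,
      P₁ ≠ 0 ∧ P₂ ≠ 0 ∧ P₃ ≠ 0 ∧ P₁ ≠ P₂ ∧ P₁ ≠ P₃ ∧ P₂ ≠ P₃ ∧
      (2 : ℤ) • P₁ = 0 ∧ (2 : ℤ) • P₂ = 0 ∧ (2 : ℤ) • P₃ = 0 ∧
      (∀ R : (W.baseChange F).toAffine.Point, (2 : ℤ) • R ≠ P₁) ∧ (2 : ℤ) • Q = P₃ := by
  obtain ⟨e₁, e₂, e₃, hs, h13, h23⟩ := exists_splitTwoTorsion_real_lt W hΔ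
  have hs₂ : (W.baseChange ℝ).toAffine.SplitTwoTorsion e₂ e₁ e₃ := hs.swap₁₂
  have hs₃ : (W.baseChange ℝ).toAffine.SplitTwoTorsion e₃ e₁ e₂ := hs.swap₂₃.swap₁₂
  set T₁ : (W.baseChange ℝ).toAffine.Point :=
    .some e₁ ((W.baseChange ℝ).toAffine.twoTorsionY e₁) (nonsingular_twoTorsion hs) with hT₁def
  set T₂ : (W.baseChange ℝ).toAffine.Point :=
    .some e₂ ((W.baseChange ℝ).toAffine.twoTorsionY e₂) (nonsingular_twoTorsion hs₂) with hT₂def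
  set T₃ : (W.baseChange ℝ).toAffine.Point :=
    .some e₃ ((W.baseChange ℝ).toAffine.twoTorsionY e₃) (nonsingular_twoTorsion hs₃) with hT₃def
  have hTT : ∀ (x : ℝ) (h : (W.baseChange ℝ).toAffine.Nonsingular x ((W.baseChange ℝ).toAffine.twoTorsionY x)),
      (Point.some x _ h : (W.baseChange ℝ).toAffine.Point) + .some x _ h = 0 :=
    fun x h ↦ Point.add_self_of_Y_eq ((W.baseChange ℝ).toAffine.negY_twoTorsionY x).symm
  -- `T₁` is not halvable over `ℝ` (there is a larger `2`-torsion abscissa `e₃`)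
  have hT₁ : ∀ R : (W.baseChange ℝ).toAffine.Point, R + R ≠ T₁ := fun R ↦
    WeierstrassCurve.add_self_ne_of_lt (W.baseChange ℝ).toAffine (equation_twoTorsion hs₃)
      ((W.baseChange ℝ).toAffine.negY_twoTorsionY e₃).symm (nonsingular_twoTorsion hs) h13 R
  -- `T₃` halves over `ℝ` (`e₃ - e₁`, `e₃ - e₂` are positive, hence squares)
  have hT₃ : ∃ R : (W.baseChange ℝ).toAffine.Point, R + R = T₃ := by
    have hsq : ∀ a : ℝ, a < e₃ → sqClass (e₃ - a) = 1 := fun a ha ↦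
      (sqClass_eq_one_iff (sub_ne_zero.mpr (ne_of_gt ha))).mpr
        ⟨Real.sqrt (e₃ - a), (Real.sq_sqrt (sub_nonneg.mpr ha.le)).symm⟩
    refine Point.exists_add_self_of_twoDescentComponent_eq_one hs T₃ ?_ ?_
    · rw [hT₃def, Point.twoDescentComponent_some_of_ne _ (ne_of_gt h13)]; exact hsq e₁ h13
    · rw [hT₃def, Point.twoDescentComponent_some_of_ne _ (ne_of_gt h23)]; exact hsq e₂ h23
  obtain ⟨R₃, hR₃⟩ := hT₃
  -- transport along `g : ℝ → F`, `f' : F → ℝ`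
  let g : ℝ →ₐ[ℚ] F := e.symm.toRingHom.toRatAlgHom
  let f' : F →ₐ[ℚ] ℝ := e.toRingHom.toRatAlgHom
  have hfg : ∀ x, f' (g x) = x := fun x ↦ e.apply_symm_apply x
  let m : (W.baseChange ℝ).toAffine.Point →+ (W.baseChange F).toAffine.Point := Point.map (W' := W) g
  have hm : Function.Injective m := Point.map_injective (W' := W) (f := g)
  have hne0 : ∀ (x : ℝ) (h : (W.baseChange ℝ).toAffine.Nonsingular x ((W.baseChange ℝ).toAffine.twoTorsionY x)),
      m (Point.some x _ h) ≠ 0 := by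
    intro x h h0
    have h0' := hm (h0.trans (map_zero m).symm)
    cases h0'
  refine ⟨m T₁, m T₂, m T₃, m R₃, hne0 _ _, hne0 _ _, hne0 _ _, ?_, ?_, ?_, ?_, ?_, ?_, ?_, ?_⟩
  · intro h
    have h' := hm h
    rw [hT₁def, hT₂def] at h'
    simp only [Point.some.injEq] at h'
    exact hs.ne₁₂ h'.1
  · intro h
    have h' := hm h
    rw [hT₁def, hT₃def] at h'
    simp only [Point.some.injEq] at h'
    exact hs.ne₁₃ h'.1
  · intro h
    have h' := hm h
    rw [hT₂def, hT₃def] at h'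
    simp only [Point.some.injEq] at h'
    exact hs.ne₂₃ h'.1
  · rw [two_zsmul, ← map_add, hT₁def, hTT, map_zero]
  · rw [two_zsmul, ← map_add, hT₂def, hTT, map_zero]
  · rw [two_zsmul, ← map_add, hT₃def, hTT, map_zero]
  · intro R h
    have h' := congrArg (Point.map (W' := W) f') h
    rw [map_zsmul, two_zsmul] at h'
    obtain ⟨h₀, hP⟩ : ∃ h₀, Point.map (W' := W) f' R + Point.map (W' := W) f' R =
        .some e₁ ((W.baseChange ℝ).toAffine.twoTorsionY e₁) h₀ := by
      refine ⟨nonsingular_twoTorsion hs, h'.trans ?_⟩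
      change Point.map (W' := W) f' (Point.map (W' := W) g T₁) = _
      rw [hT₁def, Point.map_some, Point.map_some]
      simp only [hfg]
    exact hT₁ _ hP
  · rw [two_zsmul, ← map_add, hR₃]

/-- **`#E(F)[2] ≥ 4` for `Δ > 0`, `F ≃+* ℝ`** (`O, P₁, P₂, P₃` are four distinct elements of the finite group `E(F)[2] ≃ H⁰(F, E[2]) ⊆ E[2]`).
[cite: Kramer1981, §2 Prop. 6 (p. 127)] -/
theorem four_le_natCard_ker_two [CharZero F] (e : F ≃+* ℝ) (hΔ : 0 < W.Δ) :
    4 ≤ Nat.card (zsmulAddGroupHom (2 : ℤ) : (W.baseChange F).toAffine.Point →+ _).ker := by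
  obtain ⟨P₁, P₂, P₃, -, h0₁, h0₂, h0₃, h₁₂, h₁₃, h₂₃, h2₁, h2₂, h2₃, -, -⟩ :=
    exists_twoTorsion_baseChange_of_ringEquiv W e hΔ
  have hcardE : Nat.card (geomTorsion W 2) = 4 :=
    card_torsionPoints_eq_sq_holds W (AlgebraicClosure ℚ) (n := 2) (by norm_num)
  haveI : Finite (geomTorsion W 2) := Nat.finite_of_card_ne_zero (by rw [hcardE]; norm_num)
  haveI : Finite (zsmulAddGroupHom (2 : ℤ) : (W.baseChange F).toAffine.Point →+ _).ker :=
    Finite.of_equiv _ (W.invariantsTorsionEquivKerZSMul F two_ne_zero).toEquiv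
  have mk : ∀ {P : (W.baseChange F).toAffine.Point}, (2 : ℤ) • P = 0 →
      P ∈ (zsmulAddGroupHom (2 : ℤ) : (W.baseChange F).toAffine.Point →+ _).ker := fun h ↦ by
    rw [AddMonoidHom.mem_ker, zsmulAddGroupHom_apply]; exact h
  let q₁ : (zsmulAddGroupHom (2 : ℤ) : (W.baseChange F).toAffine.Point →+ _).ker := ⟨P₁, mk h2₁⟩
  let q₂ : (zsmulAddGroupHom (2 : ℤ) : (W.baseChange F).toAffine.Point →+ _).ker := ⟨P₂, mk h2₂⟩
  let q₃ : (zsmulAddGroupHom (2 : ℤ) : (W.baseChange F).toAffine.Point →+ _).ker := ⟨P₃, mk h2₃⟩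
  have hq₂₃ : q₂ ≠ q₃ := fun h ↦ h₂₃ (congrArg Subtype.val h)
  have hq₁ : q₁ ∉ ({q₂, q₃} : Set _) := by
    simp only [Set.mem_insert_iff, Set.mem_singleton_iff, not_or]
    exact ⟨fun h ↦ h₁₂ (congrArg Subtype.val h), fun h ↦ h₁₃ (congrArg Subtype.val h)⟩
  have hq₀ : (0 : (zsmulAddGroupHom (2 : ℤ) : (W.baseChange F).toAffine.Point →+ _).ker) ∉
      ({q₁, q₂, q₃} : Set _) := by
    simp only [Set.mem_insert_iff, Set.mem_singleton_iff, not_or]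
    exact ⟨fun h ↦ h0₁ (congrArg Subtype.val h).symm, fun h ↦ h0₂ (congrArg Subtype.val h).symm,
      fun h ↦ h0₃ (congrArg Subtype.val h).symm⟩
  have hS : ({0, q₁, q₂, q₃} : Set _).ncard = 4 := by
    rw [Set.ncard_insert_of_notMem hq₀, Set.ncard_insert_of_notMem hq₁, Set.ncard_pair hq₂₃]
  calc 4 = ({0, q₁, q₂, q₃} : Set _).ncard := hS.symm
    _ ≤ _ := Set.ncard_le_card _

end RealAlgebra

/-! ## §3 `Δ > 0`: complex conjugation fixes `E[2]`, moves `E[4]`, fixes a point of order `4` -/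

section Conjugation

variable (W : WeierstrassCurve ℚ) [W.IsElliptic] {F : Type} [Field F] [Algebra ℚ F] [CharZero F]

/-- **`Δ > 0 ⟹ Γ_F` fixes `E[2](ℚ̄)` pointwise for every `ℚ`-field `F ≃+* ℝ`** (e.g. `F = ℚ_∞`: complex conjugation fixes `E[2]`; `E[2] ⊂ E(ℝ)`,
three real roots). [cite: Kramer1981, §2 Prop. 6 (p. 127)] [cite: MilneADT2006, I Lemma 3.3] -/
theorem smul_eq_self_of_two_smul_eq_zero (e : F ≃+* ℝ) (hΔ : 0 < W.Δ) (τ : absoluteGaloisGroup F)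
    (T : geomPoints W) (hT : (2 : ℤ) • T = 0) : absGaloisRestrict ℚ F τ • T = T :=
  smul_eq_self_of_card_twoTorsion W F (four_le_natCard_ker_two W e hΔ) τ T hT

/-- **`Δ > 0 ⟹` some `τ ∈ Γ_F` MOVES some point of `E[4](ℚ̄)`** for every `ℚ`-field `F ≃+* ℝ` (e.g. complex conjugation is not trivial on
`E[4]`: `E(ℝ)[4] ≠ E[4]`, the egg `2`-torsion point has no real half). [cite: Kramer1981, §2 Prop. 6 (p. 127)] [cite: SilvermanAEC2009, III.2.3(d)] -/
theorem exists_four_torsion_smul_ne (e : F ≃+* ℝ) (hΔ : 0 < W.Δ) :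
    ∃ R : geomPoints W, (4 : ℤ) • R = 0 ∧ ∃ τ : absoluteGaloisGroup F, absGaloisRestrict ℚ F τ • R ≠ R := by
  obtain ⟨P₁, -, -, -, -, -, -, -, -, -, h2₁, -, -, hP₁, -⟩ := exists_twoTorsion_baseChange_of_ringEquiv W e hΔ
  exact exists_smul_ne_of_not_two_divisible W F P₁ h2₁ hP₁

/-- **`Δ > 0 ⟹` a `Γ_F`-INVARIANT point of `E[4](ℚ̄)` of order `4`** for every `ℚ`-field `F ≃+* ℝ` (e.g. a REAL point of order `4`: halve
the identity-component `2`-torsion point over `ℝ`). [cite: Kramer1981, §2 Prop. 6 (p. 127)] [cite: SilvermanAEC2009, Prop. X.1.4] -/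
theorem exists_four_torsion_invariant (e : F ≃+* ℝ) (hΔ : 0 < W.Δ) :
    ∃ R : geomPoints W, (4 : ℤ) • R = 0 ∧ (2 : ℤ) • R ≠ 0 ∧
      ∀ τ : absoluteGaloisGroup F, absGaloisRestrict ℚ F τ • R = R := by
  obtain ⟨-, -, P₃, Q, -, -, h0₃, -, -, -, -, -, h2₃, -, hQ⟩ := exists_twoTorsion_baseChange_of_ringEquiv W e hΔ
  refine exists_invariant_of_order_four W F Q ?_ ?_
  · rw [show (4 : ℤ) = 2 * 2 by norm_num, mul_zsmul, hQ, h2₃]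
  · rw [hQ]; exact h0₃

end Conjugation

/-! ## §4 ★ Real-trivial phantom classes of `H¹(ℚ, E[2^k])` vanish (`Δ > 0`, `k ≥ 2`, `ρ̄_{E,2^k}` onto) -/

section Main

variable (W : WeierstrassCurve ℚ) [W.IsElliptic]

/-- ★ **A real-trivial phantom class is zero — unconditional form over `ℚ`.**  `E/ℚ` elliptic with `Δ > 0`, `k = j + 1 ≥ 2`, `ρ̄_{E,2^k}`
surjective, `w` the real place: every `x ∈ H¹(ℚ, E[2^k])` with `[x, ρ] = 0` for all `ρ ∈ Γ_{ℚ(E[2^k])}` and `x ∈ torsionLocalKer ℚ_w 2^k` is `0`.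
Proof: `…RealVisibleInvolution`'s `eq_zero_of_phantom_of_mem_torsionLocalKer_infinitePlace_of_isReal` at the non-trivial `σ ∈ Γ_{ℚ_w} = {1, σ}`
(`exists_ne_one_forall_eq_of_isReal`), its three archimedean clauses discharged by §3 along `ℚ_w ≃+* ℝ` (`Completion.ringEquivRealOfIsReal`):
complex conjugation fixes `E[2]`, moves some `R ∈ E[4] ⊆ E[2^k]`, and fixes some `R ∈ E[4]` with `2R ≠ 0` (so `cR = R ≠ -R`).  LINE 27 (HL) reading:
the level-raised real-trivial `2`-Selmer line of `E/ℚ` carries NO non-zero phantom class.  BSD is NOT proved by this.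
[cite: LawsonWuthrich2016, Lemma 3, §7.1] [cite: Kramer1981, §2 Prop. 6 (p. 127)] [cite: SerreGaloisCohomology1997, II.§6.1] -/
theorem eq_zero_of_phantom_of_mem_torsionLocalKer_rat (hΔ : 0 < W.Δ) (j : ℕ) (hj : j ≠ 0)
    (hsurj : W.HasSurjectiveModNGaloisRep ((2 ^ (j + 1) : ℕ) : ℤ)) (w : InfinitePlace ℚ)
    {x : galH1Torsion W ((2 ^ (j + 1) : ℕ) : ℤ)}
    (hph : ∀ ρ ∈ torsionFixing W ((2 ^ (j + 1) : ℕ) : ℤ), h1Eval W _ x ρ = 0)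
    (hloc : x ∈ W.torsionLocalKer w.Completion ((2 ^ (j + 1) : ℕ) : ℤ)) : x = 0 := by
  have hw : w.IsReal := IsTotallyReal.isReal w
  obtain ⟨σ, hσ, hall⟩ := exists_ne_one_forall_eq_of_isReal hw
  obtain ⟨k, rfl⟩ : ∃ k, j = k + 1 := ⟨j - 1, (Nat.succ_pred_eq_of_ne_zero hj).symm⟩
  have hpow : ((2 ^ (k + 1 + 1) : ℕ) : ℤ) = 2 ^ k * 4 := by push_cast; ring
  have hmem4 : ∀ {R : geomPoints W}, (4 : ℤ) • R = 0 → R ∈ geomTorsion W ((2 ^ (k + 1 + 1) : ℕ) : ℤ) :=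
    fun hR ↦ by rw [mem_geomTorsion_iff, hpow, mul_zsmul, hR, zsmul_zero]
  -- the three archimedean facts, read through the completion's OWN `ℚ`-algebra structure (the one the local condition uses)
  haveI hcz : CharZero w.Completion := charZero_of_injective_algebraMap (algebraMap ℚ w.Completion).injective
  let e : w.Completion ≃+* ℝ := InfinitePlace.Completion.ringEquivRealOfIsReal hw
  have hfix := @smul_eq_self_of_two_smul_eq_zero W _ w.Completion _ (InfinitePlace.Completion.instAlgebra w ℚ) _ e hΔ σ
  obtain ⟨R₁, hR₁4, τ, hτ⟩ :=
    @exists_four_torsion_smul_ne W _ w.Completion _ (InfinitePlace.Completion.instAlgebra w ℚ) _ e hΔ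
  obtain ⟨R₂, hR₂4, hR₂2, hinv⟩ :=
    @exists_four_torsion_invariant W _ w.Completion _ (InfinitePlace.Completion.instAlgebra w ℚ) _ e hΔ
  refine eq_zero_of_phantom_of_mem_torsionLocalKer_infinitePlace_of_isReal W (k + 1) hsurj hw hσ ?_ ?_ ?_ hph hloc
  · intro T hT
    rw [resGal_eq_absGaloisRestrict]
    exact hfix T hT
  · have hτ1 : τ ≠ 1 := by
      rintro rfl
      rw [map_one, one_smul] at hτ
      exact hτ rfl
    have hτσ : τ = σ := (hall τ).resolve_left hτ1
    refine ⟨⟨R₁, hmem4 hR₁4⟩, fun h ↦ hτ ?_⟩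
    have h' := congrArg Subtype.val h
    rw [AddSubgroup.torsionBy.coe_smul, resGal_eq_absGaloisRestrict] at h'
    rw [hτσ]
    exact h'
  · refine ⟨⟨R₂, hmem4 hR₂4⟩, fun h ↦ hR₂2 ?_⟩
    have h' := congrArg Subtype.val h
    rw [AddSubgroup.torsionBy.coe_smul, resGal_eq_absGaloisRestrict, AddSubgroup.coe_neg, hinv σ] at h'
    change R₂ = -R₂ at h'
    rw [two_zsmul]
    exact eq_neg_iff_add_eq_zero.mp h'

end Main

end Summit.BirchSwinnertonDyer.BirchSwinnertonDyer.Theorems.GenusExact.PlusDescent.SocleSelection.RealVisible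

end
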